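import Literature.MathematicalPhysics.QuantumChemistry.SpinClassNecessaryConditions
import HarnessLib

/-!
# Dual-cone (SDP weak-duality) certificates over SEVERAL condition families: the slack form and the
# two-family form of Cancès–Stoltz–Lewin eq. (8)

Companion of `DualConeLowerBound.lean` (`PosMapFeasible`, `le_re_rdmEnergy_of_dualCone_certificate` and
its sector / `N` / spin-class forms), which states the dual-cone certificate for ONE finite family of
positivity conditions `𝓛_c`, `c : κ`, with ONE dependent family of block index types `X c`. A concrete
relaxation routinely combines families with DIFFERENT block index types — the base programme's P, Q, G
(T1, T2′, …) blocks and, e.g., scalar (`1 × 1`) subsystem rows or compressed cut blocks — and the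
disjoint-union family over `κ₁ ⊕ κ₂` with block types `Sum.elim X₁ X₂` is awkward in Lean (its `Fintype`
/ `DecidableEq` instances do not synthesise at a variable index). This file gives the two instance-free
forms every such certificate needs, each PROVED (0 sorry, no new definition):

1. **Slack form** (`le_re_rdmEnergy_of_slack_certificate` + sector / `N` / spin-class forms): if
   `E(γ, Γ) − μ = S(γ, Γ) + Σ_r λ_r (A_r(γ, Γ) − b_r)` for all pairs and `0 ≤ Re S` on every `P`-feasible
   pair, then `μ ≤ Re E(γ, Γ)` on the `P`-feasible pairs satisfying the rows, hence `μ ≤ E₀` when `P` and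
   the rows are necessary. The single-family theorem is the instance `S = Σ_c tr(B_c 𝓛_c)`,
   `P = PosMapFeasible L` (`re_sum_trace_mul_nonneg_of_posMapFeasible`); slacks ADD, so any number of
   families combine.
2. **Two-family form** (`le_re_rdmEnergy_of_dualCone_pairCertificate` + sector / `N` / spin-class forms):
   `E(γ, Γ) − μ = Σ_c tr(B¹_c 𝓛¹_c(γ, Γ)) + Σ_d tr(B²_d 𝓛²_d(γ, Γ)) + Σ_r λ_r (A_r − b_r)` with `B¹_c, B²_d ⪰ 0`
   ⇒ `μ ≤ Re E` on pairs feasible for BOTH families — CSL eq. (8) with the condition list `ℓ = 1…L` split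
   over two block-index types; in cone language `𝒞₁* + 𝒞₂* ⊆ (𝒞₁ ∩ 𝒞₂)*`.

Source (held copy `paper:arxiv-quant-ph_0602042`, p. 5, opened): "the polar cone `𝒞*` of a cone `𝒞` … is
defined as `𝒞* = {x | ∀ y ∈ 𝒞, ⟨x, y⟩ ≥ 0}`"; eq. (7) "`∀ ℓ = 1…L, 𝓛_ℓ(Γ) ≥ 0`"; eq. (8)
"`(𝒞_app)* := {Σ_{ℓ=1}^L (𝓛_ℓ)* B_ℓ | B_ℓ ∈ 𝒮(X_ℓ), B_ℓ ≥ 0}`"; "since `𝒞_app ⊃ 𝒞_N`, the energy `E_app` is a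
lower bound to the full CI energy in the chosen basis"; "Additional necessary conditions can be
considered, such as Erdahl's T₁ and T₂ conditions" (adding conditions = extending the list). NOT HERE: the
flip-quotient (`θ`-symmetric) certificate identity, strong duality, any float arithmetic.

## Mathlib / tree search

`lean search 'posMapFeasible|PosMapFeasible'` (2026-08-27): `DualConeLowerBound` (def, P/Q/G family,
pairing lemma, one-family certificate ×3), `NecessaryConditionInstances.isNecessary(InSector)_posMapFeasible`,
`SpinClassNecessaryConditions.{isNecessaryInSpinClass_posMapFeasible, le_minEnergyOn_spinClass_of_dualCone_certificate}`,
venture-side `Rows/SubsystemRows.posMapFeasible_subsystemBlocks_iff`, `Rows/SubsystemSectorRows.…SectorBlocks_iff`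
(the second families of record); no two-family or slack form. REUSED: `re_sum_trace_mul_nonneg_of_posMapFeasible`,
`le_sectorGroundEnergy_of_forall_necessary`, `le_groundEnergy_of_forall_necessary`,
`le_minEnergyOn_spinClass_of_forall_necessary`, `IsNecessary(InSector|InSpinClass).and`.

## References

* E. Cancès, G. Stoltz, M. Lewin, J. Chem. Phys. 125 (2006) 064101 = arXiv:quant-ph/0602042, §3 eqs.
  (7)–(10). [cite: CancesStoltzLewin2006, §3 eqs. (7)-(10)]
-/

namespace Literature.MathematicalPhysics.QuantumChemistry

open Matrix Finset Literature.MathematicalPhysics.QuantumLattice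
open scoped ComplexOrder

variable {Λ : Type*} [LinearOrder Λ] [Fintype Λ]

/-! ## §1 The slack form of the dual-cone certificate -/

section Slack

omit [LinearOrder Λ] in
/-- **WEAK DUALITY, SLACK FORM (pointwise).** Data: a feasibility predicate `P` on pairs, a complex
"slack" functional `S` with `0 ≤ Re S(γ, Γ)` on every `P`-feasible pair, free multipliers `λ_r` for
finitely many equality rows `A_r = b_r`, a real `μ` and the Lagrangian identity
`E(γ, Γ) − μ = S(γ, Γ) + Σ_r λ_r (A_r(γ, Γ) − b_r)` for ALL pairs. Then `μ ≤ Re E(γ, Γ)` at every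
`P`-feasible pair satisfying the rows. With `S = Σ_ℓ tr(B_ℓ 𝓛_ℓ(γ, Γ))`, `B_ℓ ≥ 0`, this is CSL's
`K_N − μ ∈ (𝒞_app)*` read at one point ("`𝒞* = {x | ∀ y ∈ 𝒞, ⟨x, y⟩ ≥ 0}`"); the slack form lets several
positivity families (different block index types) and scalar inequality rows enter one identity, since
their slacks add. [cite: CancesStoltzLewin2006, §3 eqs. (8), (10)] -/
theorem le_re_rdmEnergy_of_slack_certificate (h : Λ → Λ → ℂ) (g : Λ → Λ → Λ → Λ → ℂ) (hnuc : ℂ)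
    (P : Matrix (Orb Λ) (Orb Λ) ℂ → Matrix (Orb Λ × Orb Λ) (Orb Λ × Orb Λ) ℂ → Prop)
    (S : Matrix (Orb Λ) (Orb Λ) ℂ → Matrix (Orb Λ × Orb Λ) (Orb Λ × Orb Λ) ℂ → ℂ)
    (hS : ∀ γ Γ, P γ Γ → 0 ≤ (S γ Γ).re) {ρ : Type*} [Fintype ρ]
    (A : ρ → Matrix (Orb Λ) (Orb Λ) ℂ → Matrix (Orb Λ × Orb Λ) (Orb Λ × Orb Λ) ℂ → ℂ) (rhs : ρ → ℂ)
    (lam : ρ → ℂ) {μ : ℝ}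
    (hcert : ∀ γ Γ, rdmEnergy h g hnuc γ Γ - (μ : ℂ) = S γ Γ + ∑ r, lam r * (A r γ Γ - rhs r))
    {γ : Matrix (Orb Λ) (Orb Λ) ℂ} {Γ : Matrix (Orb Λ × Orb Λ) (Orb Λ × Orb Λ) ℂ}
    (hP : P γ Γ) (hA : ∀ r, A r γ Γ = rhs r) : μ ≤ (rdmEnergy h g hnuc γ Γ).re := by
  have hrows : ∑ r, lam r * (A r γ Γ - rhs r) = 0 :=
    Finset.sum_eq_zero fun r _ => by rw [hA r, sub_self, mul_zero]
  have hid := congrArg Complex.re (hcert γ Γ)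
  rw [hrows, add_zero, Complex.sub_re, Complex.ofReal_re] at hid
  have h0 := hS γ Γ hP
  linarith

/-- **SLACK CERTIFICATE ⇒ SECTOR GROUND-ENERGY LOWER BOUND.** Hermitian integral data, a non-trivial
sector `a, b ≤ |Λ|`, `P` and the rows `A_r = b_r` NECESSARY in the sector `(a, b)`, and the slack
certificate of `le_re_rdmEnergy_of_slack_certificate`: `μ ≤ E₀(Ĥ; N_α = a, N_β = b)` — "since
`𝒞_app ⊃ 𝒞_N`, the energy `E_app` is a lower bound", one dual-feasible point, sector form.
[cite: CancesStoltzLewin2006, §3 eqs. (8)-(10)] -/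
theorem le_sectorGroundEnergy_of_slack_certificate {h : Λ → Λ → ℂ} {g : Λ → Λ → Λ → Λ → ℂ}
    {hnuc : ℂ} (hH : (molecularHamiltonian h g hnuc).IsHermitian) {a b : ℕ} (ha : a ≤ Fintype.card Λ)
    (hb : b ≤ Fintype.card Λ)
    (P : Matrix (Orb Λ) (Orb Λ) ℂ → Matrix (Orb Λ × Orb Λ) (Orb Λ × Orb Λ) ℂ → Prop)
    (hPn : IsNecessaryInSector a b P)
    (S : Matrix (Orb Λ) (Orb Λ) ℂ → Matrix (Orb Λ × Orb Λ) (Orb Λ × Orb Λ) ℂ → ℂ)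
    (hS : ∀ γ Γ, P γ Γ → 0 ≤ (S γ Γ).re) {ρ : Type*} [Fintype ρ]
    (A : ρ → Matrix (Orb Λ) (Orb Λ) ℂ → Matrix (Orb Λ × Orb Λ) (Orb Λ × Orb Λ) ℂ → ℂ) (rhs : ρ → ℂ)
    (hArows : IsNecessaryInSector a b fun γ Γ => ∀ r, A r γ Γ = rhs r) (lam : ρ → ℂ) {μ : ℝ}
    (hcert : ∀ γ Γ, rdmEnergy h g hnuc γ Γ - (μ : ℂ) = S γ Γ + ∑ r, lam r * (A r γ Γ - rhs r)) :
    μ ≤ sectorGroundEnergy (molecularHamiltonian h g hnuc) a b :=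
  le_sectorGroundEnergy_of_forall_necessary hH ha hb (hPn.and hArows)
    fun _ _ hf => le_re_rdmEnergy_of_slack_certificate h g hnuc P S hS A rhs lam hcert hf.1 hf.2

/-- **SLACK CERTIFICATE ⇒ `N`-ELECTRON GROUND-ENERGY LOWER BOUND** (CSL's own setting): `P` and the rows
necessary for `N` electrons, `N ≤ 2|Λ|` ⇒ `μ ≤ E₀(Ĥ; N)`. [cite: CancesStoltzLewin2006, §3 eqs. (8)-(10)] -/
theorem le_groundEnergy_of_slack_certificate (h : Λ → Λ → ℂ) (g : Λ → Λ → Λ → Λ → ℂ) (hnuc : ℂ)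
    {N : ℕ} (hN : N ≤ Fintype.card (Orb Λ))
    (P : Matrix (Orb Λ) (Orb Λ) ℂ → Matrix (Orb Λ × Orb Λ) (Orb Λ × Orb Λ) ℂ → Prop)
    (hPn : IsNecessary N P)
    (S : Matrix (Orb Λ) (Orb Λ) ℂ → Matrix (Orb Λ × Orb Λ) (Orb Λ × Orb Λ) ℂ → ℂ)
    (hS : ∀ γ Γ, P γ Γ → 0 ≤ (S γ Γ).re) {ρ : Type*} [Fintype ρ]
    (A : ρ → Matrix (Orb Λ) (Orb Λ) ℂ → Matrix (Orb Λ × Orb Λ) (Orb Λ × Orb Λ) ℂ → ℂ) (rhs : ρ → ℂ)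
    (hArows : IsNecessary N fun γ Γ => ∀ r, A r γ Γ = rhs r) (lam : ρ → ℂ) {μ : ℝ}
    (hcert : ∀ γ Γ, rdmEnergy h g hnuc γ Γ - (μ : ℂ) = S γ Γ + ∑ r, lam r * (A r γ Γ - rhs r)) :
    μ ≤ Literature.MathematicalPhysics.QuantumLattice.groundEnergy (molecularHamiltonian h g hnuc) N :=
  le_groundEnergy_of_forall_necessary h g hnuc hN (hPn.and hArows)
    fun _ _ hf => le_re_rdmEnergy_of_slack_certificate h g hnuc P S hS A rhs lam hcert hf.1 hf.2

/-- **SLACK CERTIFICATE ⇒ SPIN-CLASS LOWER BOUND** (`b ≤ a ≤ |Λ|`; `P` and the rows necessary for the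
highest-weight class of the sector `(a, b)`, e.g. including the `S`-row): `μ ≤ E₀(Ĥ; a, b, S = M)`.
[cite: CancesStoltzLewin2006, §3 eqs. (8)-(10)] -/
theorem le_minEnergyOn_spinClass_of_slack_certificate (h : Λ → Λ → ℂ) (g : Λ → Λ → Λ → Λ → ℂ)
    (hnuc : ℂ) {a b : ℕ} (hba : b ≤ a) (ha : a ≤ Fintype.card Λ)
    (P : Matrix (Orb Λ) (Orb Λ) ℂ → Matrix (Orb Λ × Orb Λ) (Orb Λ × Orb Λ) ℂ → Prop)
    (hPn : IsNecessaryInSpinClass a b P)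
    (S : Matrix (Orb Λ) (Orb Λ) ℂ → Matrix (Orb Λ × Orb Λ) (Orb Λ × Orb Λ) ℂ → ℂ)
    (hS : ∀ γ Γ, P γ Γ → 0 ≤ (S γ Γ).re) {ρ : Type*} [Fintype ρ]
    (A : ρ → Matrix (Orb Λ) (Orb Λ) ℂ → Matrix (Orb Λ × Orb Λ) (Orb Λ × Orb Λ) ℂ → ℂ) (rhs : ρ → ℂ)
    (hArows : IsNecessaryInSpinClass a b fun γ Γ => ∀ r, A r γ Γ = rhs r) (lam : ρ → ℂ) {μ : ℝ}
    (hcert : ∀ γ Γ, rdmEnergy h g hnuc γ Γ - (μ : ℂ) = S γ Γ + ∑ r, lam r * (A r γ Γ - rhs r)) :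
    μ ≤ (molecularHamiltonian h g hnuc).minEnergyOn
      (szSector (a + b) (((a : ℝ) - b) / 2) ⊓ LinearMap.ker (Matrix.toLin'
        (spinPlus : Matrix (Finset (Orb Λ)) (Finset (Orb Λ)) ℂ))) :=
  le_minEnergyOn_spinClass_of_forall_necessary h g hnuc hba ha (hPn.and hArows)
    fun _ _ hf => le_re_rdmEnergy_of_slack_certificate h g hnuc P S hS A rhs lam hcert hf.1 hf.2

end Slack

/-! ## §2 Two positivity families with different block index types (CSL eq. (8), list split in two) -/

section TwoFamilies

variable {κ₁ : Type*} [Fintype κ₁] {X₁ : κ₁ → Type*} [∀ c, Fintype (X₁ c)] [∀ c, DecidableEq (X₁ c)]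
variable {κ₂ : Type*} [Fintype κ₂] {X₂ : κ₂ → Type*} [∀ c, Fintype (X₂ c)] [∀ c, DecidableEq (X₂ c)]

omit [LinearOrder Λ] [Fintype Λ] in
/-- **The two-family pairing is nonnegative on pairs feasible for both families**: `B¹_c, B²_d ⪰ 0`,
`𝓛¹_c(γ, Γ) ⪰ 0`, `𝓛²_d(γ, Γ) ⪰ 0` ⇒ `0 ≤ Re (Σ_c tr(B¹_c 𝓛¹_c(γ, Γ)) + Σ_d tr(B²_d 𝓛²_d(γ, Γ)))` — the reason
`Σ_ℓ (𝓛_ℓ)* B_ℓ` over the concatenated list lies in the polar cone of the intersection (eq. (8)).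
[cite: CancesStoltzLewin2006, §3 eq. (8)] -/
theorem re_add_sum_trace_mul_nonneg_of_posMapFeasible
    {L₁ : ∀ c : κ₁, Matrix (Orb Λ) (Orb Λ) ℂ → Matrix (Orb Λ × Orb Λ) (Orb Λ × Orb Λ) ℂ →
      Matrix (X₁ c) (X₁ c) ℂ}
    {L₂ : ∀ c : κ₂, Matrix (Orb Λ) (Orb Λ) ℂ → Matrix (Orb Λ × Orb Λ) (Orb Λ × Orb Λ) ℂ →
      Matrix (X₂ c) (X₂ c) ℂ}
    {B₁ : ∀ c : κ₁, Matrix (X₁ c) (X₁ c) ℂ} {B₂ : ∀ c : κ₂, Matrix (X₂ c) (X₂ c) ℂ}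
    (hB₁ : ∀ c, (B₁ c).PosSemidef) (hB₂ : ∀ c, (B₂ c).PosSemidef)
    {γ : Matrix (Orb Λ) (Orb Λ) ℂ} {Γ : Matrix (Orb Λ × Orb Λ) (Orb Λ × Orb Λ) ℂ}
    (hf₁ : PosMapFeasible L₁ γ Γ) (hf₂ : PosMapFeasible L₂ γ Γ) :
    0 ≤ (∑ c, (B₁ c * L₁ c γ Γ).trace + ∑ c, (B₂ c * L₂ c γ Γ).trace).re := by
  rw [Complex.add_re]
  exact add_nonneg (re_sum_trace_mul_nonneg_of_posMapFeasible hB₁ hf₁)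
    (re_sum_trace_mul_nonneg_of_posMapFeasible hB₂ hf₂)

omit [LinearOrder Λ] in
/-- **WEAK DUALITY FOR TWO CONDITION FAMILIES (pointwise).** Families `𝓛¹` (block types `X₁ c`) and
`𝓛²` (block types `X₂ d`), multipliers `B¹_c, B²_d ⪰ 0`, free multipliers `λ_r` for equality rows
`A_r = b_r`, a real `μ`, and the Lagrangian identity
`E(γ, Γ) − μ = Σ_c tr(B¹_c 𝓛¹_c(γ, Γ)) + Σ_d tr(B²_d 𝓛²_d(γ, Γ)) + Σ_r λ_r (A_r(γ, Γ) − b_r)` for ALL pairs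
(`K_N − μ ∈ (𝒞_app)* = {Σ_ℓ (𝓛_ℓ)* B_ℓ | B_ℓ ≥ 0}`, eq. (8), for the concatenated list). Then `μ ≤ Re E(γ, Γ)`
at every pair feasible for both families and satisfying the rows. [cite: CancesStoltzLewin2006, §3 eqs. (8), (10)] -/
theorem le_re_rdmEnergy_of_dualCone_pairCertificate (h : Λ → Λ → ℂ) (g : Λ → Λ → Λ → Λ → ℂ)
    (hnuc : ℂ)
    (L₁ : ∀ c : κ₁, Matrix (Orb Λ) (Orb Λ) ℂ → Matrix (Orb Λ × Orb Λ) (Orb Λ × Orb Λ) ℂ →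
      Matrix (X₁ c) (X₁ c) ℂ)
    (L₂ : ∀ c : κ₂, Matrix (Orb Λ) (Orb Λ) ℂ → Matrix (Orb Λ × Orb Λ) (Orb Λ × Orb Λ) ℂ →
      Matrix (X₂ c) (X₂ c) ℂ)
    {ρ : Type*} [Fintype ρ]
    (A : ρ → Matrix (Orb Λ) (Orb Λ) ℂ → Matrix (Orb Λ × Orb Λ) (Orb Λ × Orb Λ) ℂ → ℂ) (rhs : ρ → ℂ)
    {B₁ : ∀ c : κ₁, Matrix (X₁ c) (X₁ c) ℂ} (hB₁ : ∀ c, (B₁ c).PosSemidef)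
    {B₂ : ∀ c : κ₂, Matrix (X₂ c) (X₂ c) ℂ} (hB₂ : ∀ c, (B₂ c).PosSemidef) (lam : ρ → ℂ) {μ : ℝ}
    (hcert : ∀ γ Γ, rdmEnergy h g hnuc γ Γ - (μ : ℂ) =
      ∑ c, (B₁ c * L₁ c γ Γ).trace + ∑ c, (B₂ c * L₂ c γ Γ).trace +
        ∑ r, lam r * (A r γ Γ - rhs r))
    {γ : Matrix (Orb Λ) (Orb Λ) ℂ} {Γ : Matrix (Orb Λ × Orb Λ) (Orb Λ × Orb Λ) ℂ}
    (hf₁ : PosMapFeasible L₁ γ Γ) (hf₂ : PosMapFeasible L₂ γ Γ) (hA : ∀ r, A r γ Γ = rhs r) :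
    μ ≤ (rdmEnergy h g hnuc γ Γ).re :=
  le_re_rdmEnergy_of_slack_certificate h g hnuc (fun γ Γ => PosMapFeasible L₁ γ Γ ∧ PosMapFeasible L₂ γ Γ)
    (fun γ Γ => ∑ c, (B₁ c * L₁ c γ Γ).trace + ∑ c, (B₂ c * L₂ c γ Γ).trace)
    (fun _ _ hf => re_add_sum_trace_mul_nonneg_of_posMapFeasible hB₁ hB₂ hf.1 hf.2) A rhs lam hcert
    ⟨hf₁, hf₂⟩ hA

/-- **TWO-FAMILY DUAL-CONE CERTIFICATE ⇒ SECTOR GROUND-ENERGY LOWER BOUND**: Hermitian data, `a, b ≤ |Λ|`,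
both families and the rows NECESSARY in the sector `(a, b)` ⇒ `μ ≤ E₀(Ĥ; N_α = a, N_β = b)`.
[cite: CancesStoltzLewin2006, §3 eqs. (8)-(10)] -/
theorem le_sectorGroundEnergy_of_dualCone_pairCertificate {h : Λ → Λ → ℂ} {g : Λ → Λ → Λ → Λ → ℂ}
    {hnuc : ℂ} (hH : (molecularHamiltonian h g hnuc).IsHermitian) {a b : ℕ} (ha : a ≤ Fintype.card Λ)
    (hb : b ≤ Fintype.card Λ)
    (L₁ : ∀ c : κ₁, Matrix (Orb Λ) (Orb Λ) ℂ → Matrix (Orb Λ × Orb Λ) (Orb Λ × Orb Λ) ℂ →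
      Matrix (X₁ c) (X₁ c) ℂ) (hL₁ : IsNecessaryInSector a b (PosMapFeasible L₁))
    (L₂ : ∀ c : κ₂, Matrix (Orb Λ) (Orb Λ) ℂ → Matrix (Orb Λ × Orb Λ) (Orb Λ × Orb Λ) ℂ →
      Matrix (X₂ c) (X₂ c) ℂ) (hL₂ : IsNecessaryInSector a b (PosMapFeasible L₂))
    {ρ : Type*} [Fintype ρ]
    (A : ρ → Matrix (Orb Λ) (Orb Λ) ℂ → Matrix (Orb Λ × Orb Λ) (Orb Λ × Orb Λ) ℂ → ℂ) (rhs : ρ → ℂ)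
    (hArows : IsNecessaryInSector a b fun γ Γ => ∀ r, A r γ Γ = rhs r)
    {B₁ : ∀ c : κ₁, Matrix (X₁ c) (X₁ c) ℂ} (hB₁ : ∀ c, (B₁ c).PosSemidef)
    {B₂ : ∀ c : κ₂, Matrix (X₂ c) (X₂ c) ℂ} (hB₂ : ∀ c, (B₂ c).PosSemidef) (lam : ρ → ℂ) {μ : ℝ}
    (hcert : ∀ γ Γ, rdmEnergy h g hnuc γ Γ - (μ : ℂ) =
      ∑ c, (B₁ c * L₁ c γ Γ).trace + ∑ c, (B₂ c * L₂ c γ Γ).trace +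
        ∑ r, lam r * (A r γ Γ - rhs r)) :
    μ ≤ sectorGroundEnergy (molecularHamiltonian h g hnuc) a b :=
  le_sectorGroundEnergy_of_forall_necessary hH ha hb ((hL₁.and hL₂).and hArows)
    fun _ _ hf => le_re_rdmEnergy_of_dualCone_pairCertificate h g hnuc L₁ L₂ A rhs hB₁ hB₂ lam hcert
      hf.1.1 hf.1.2 hf.2

/-- **TWO-FAMILY DUAL-CONE CERTIFICATE ⇒ `N`-ELECTRON LOWER BOUND** (`N ≤ 2|Λ|`, both families and the
rows necessary for `N` electrons): `μ ≤ E₀(Ĥ; N)`. [cite: CancesStoltzLewin2006, §3 eqs. (8)-(10)] -/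
theorem le_groundEnergy_of_dualCone_pairCertificate (h : Λ → Λ → ℂ) (g : Λ → Λ → Λ → Λ → ℂ)
    (hnuc : ℂ) {N : ℕ} (hN : N ≤ Fintype.card (Orb Λ))
    (L₁ : ∀ c : κ₁, Matrix (Orb Λ) (Orb Λ) ℂ → Matrix (Orb Λ × Orb Λ) (Orb Λ × Orb Λ) ℂ →
      Matrix (X₁ c) (X₁ c) ℂ) (hL₁ : IsNecessary N (PosMapFeasible L₁))
    (L₂ : ∀ c : κ₂, Matrix (Orb Λ) (Orb Λ) ℂ → Matrix (Orb Λ × Orb Λ) (Orb Λ × Orb Λ) ℂ →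
      Matrix (X₂ c) (X₂ c) ℂ) (hL₂ : IsNecessary N (PosMapFeasible L₂))
    {ρ : Type*} [Fintype ρ]
    (A : ρ → Matrix (Orb Λ) (Orb Λ) ℂ → Matrix (Orb Λ × Orb Λ) (Orb Λ × Orb Λ) ℂ → ℂ) (rhs : ρ → ℂ)
    (hArows : IsNecessary N fun γ Γ => ∀ r, A r γ Γ = rhs r)
    {B₁ : ∀ c : κ₁, Matrix (X₁ c) (X₁ c) ℂ} (hB₁ : ∀ c, (B₁ c).PosSemidef)
    {B₂ : ∀ c : κ₂, Matrix (X₂ c) (X₂ c) ℂ} (hB₂ : ∀ c, (B₂ c).PosSemidef) (lam : ρ → ℂ) {μ : ℝ}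
    (hcert : ∀ γ Γ, rdmEnergy h g hnuc γ Γ - (μ : ℂ) =
      ∑ c, (B₁ c * L₁ c γ Γ).trace + ∑ c, (B₂ c * L₂ c γ Γ).trace +
        ∑ r, lam r * (A r γ Γ - rhs r)) :
    μ ≤ Literature.MathematicalPhysics.QuantumLattice.groundEnergy (molecularHamiltonian h g hnuc) N :=
  le_groundEnergy_of_forall_necessary h g hnuc hN ((hL₁.and hL₂).and hArows)
    fun _ _ hf => le_re_rdmEnergy_of_dualCone_pairCertificate h g hnuc L₁ L₂ A rhs hB₁ hB₂ lam hcert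
      hf.1.1 hf.1.2 hf.2

/-- **TWO-FAMILY DUAL-CONE CERTIFICATE ⇒ SPIN-CLASS LOWER BOUND** (`b ≤ a ≤ |Λ|`, both families and the rows
necessary for the highest-weight class of `(a, b)`): `μ ≤ E₀(Ĥ; a, b, S = M)`.
[cite: CancesStoltzLewin2006, §3 eqs. (8)-(10)] -/
theorem le_minEnergyOn_spinClass_of_dualCone_pairCertificate (h : Λ → Λ → ℂ)
    (g : Λ → Λ → Λ → Λ → ℂ) (hnuc : ℂ) {a b : ℕ} (hba : b ≤ a) (ha : a ≤ Fintype.card Λ)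
    (L₁ : ∀ c : κ₁, Matrix (Orb Λ) (Orb Λ) ℂ → Matrix (Orb Λ × Orb Λ) (Orb Λ × Orb Λ) ℂ →
      Matrix (X₁ c) (X₁ c) ℂ) (hL₁ : IsNecessaryInSpinClass a b (PosMapFeasible L₁))
    (L₂ : ∀ c : κ₂, Matrix (Orb Λ) (Orb Λ) ℂ → Matrix (Orb Λ × Orb Λ) (Orb Λ × Orb Λ) ℂ →
      Matrix (X₂ c) (X₂ c) ℂ) (hL₂ : IsNecessaryInSpinClass a b (PosMapFeasible L₂))
    {ρ : Type*} [Fintype ρ]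
    (A : ρ → Matrix (Orb Λ) (Orb Λ) ℂ → Matrix (Orb Λ × Orb Λ) (Orb Λ × Orb Λ) ℂ → ℂ) (rhs : ρ → ℂ)
    (hArows : IsNecessaryInSpinClass a b fun γ Γ => ∀ r, A r γ Γ = rhs r)
    {B₁ : ∀ c : κ₁, Matrix (X₁ c) (X₁ c) ℂ} (hB₁ : ∀ c, (B₁ c).PosSemidef)
    {B₂ : ∀ c : κ₂, Matrix (X₂ c) (X₂ c) ℂ} (hB₂ : ∀ c, (B₂ c).PosSemidef) (lam : ρ → ℂ) {μ : ℝ}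
    (hcert : ∀ γ Γ, rdmEnergy h g hnuc γ Γ - (μ : ℂ) =
      ∑ c, (B₁ c * L₁ c γ Γ).trace + ∑ c, (B₂ c * L₂ c γ Γ).trace +
        ∑ r, lam r * (A r γ Γ - rhs r)) :
    μ ≤ (molecularHamiltonian h g hnuc).minEnergyOn
      (szSector (a + b) (((a : ℝ) - b) / 2) ⊓ LinearMap.ker (Matrix.toLin'
        (spinPlus : Matrix (Finset (Orb Λ)) (Finset (Orb Λ)) ℂ))) :=
  le_minEnergyOn_spinClass_of_forall_necessary h g hnuc hba ha ((hL₁.and hL₂).and hArows)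
    fun _ _ hf => le_re_rdmEnergy_of_dualCone_pairCertificate h g hnuc L₁ L₂ A rhs hB₁ hB₂ lam hcert
      hf.1.1 hf.1.2 hf.2

end TwoFamilies

end Literature.MathematicalPhysics.QuantumChemistry
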